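import Summits.HubbardSuperconductivity.HubbardSuperconductivity.Theorems.ThermalWedgeTwSeededEnsembleEquivalenceRColdAssembly
import Summits.HubbardSuperconductivity.HubbardSuperconductivity.Theorems.ThermalWedgeTwSeededEnsembleEquivalenceRFreeSeededRegularity
import Summits.HubbardSuperconductivity.HubbardSuperconductivity.Theorems.ThermalWedgeTwSeededEnsembleEquivalenceRSharpThermalCloser
import Summits.HubbardSuperconductivity.HubbardSuperconductivity.Theorems.TwSeededEnsembleEquivalence.Negative.CouplingTransfer
import Summits.HubbardSuperconductivity.HubbardSuperconductivity.Theorems.TwSeededEnsembleEquivalence.Negative.DefectFloor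

/-!
# Crux `TwSeededEnsembleEquivalenceR` (stmt-HubbardSuperconductivity-15581), line `cold-floor-collapse`
# (slug `Sketch`), lead c5 — the HOT-WINDOW THEOREM: the crux body is UNCONDITIONAL on the polynomial window `βU ≤ c_δ`

Support file (`--supports stmt-HubbardSuperconductivity-15581`; sorry-free; no definition; imports the route file only
through the landed AHM port `twApproximatingHamiltonian_proof` and the negative-side transfer lemmas).

The crux R asks the canonical/grand-canonical defect bound `D_L(β,μ;U,g) := e_L(g) + p_L(β,μ,U,g) − μ n_L ≤ log 4/β + ε`
on the EXPONENTIAL thermal window `1 ≤ β ≤ e^{a/U}`. This file proves it, with no physics input at all, on every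
POLYNOMIAL window `1 ≤ β ≤ c_δ/U`, `c_δ := log 4 − 2h((1−δ)/2) > 0` (`h = Real.binEntropy`; `c_δ ∈ [0.0100, 0.165]` on
`δ ∈ [1/10, 2/5]`), for EVERY seed `g ∈ (0, 1/10]` (no seed floor needed):

* `freeSeededDifferentiablePressure` — (TDL)+(DIFF)+(EDGE) of the FREE (`U = 0`) seeded pressure at every
  `β ≥ 20000` (S3 `stub_sourcedPressureLimit` + AHM `twApproximatingHamiltonian_proof` + S1 `stub_danskinEnvelope` +
  `hw_freeSeededRegularity`, assembled exactly as S5 `stub_coldAssembly`);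
* `defect_le_free_add_U` — the finite-volume defect is `1`-Lipschitz in the repulsion:
  `D_L(β,μ;U,g) ≤ D_L(β,μ;0,g) + U` (`e_L(U) ≤ e_L(0) + U` by `minEnergyOn_seededCan_le_add_U`; `p_L(U) ≤ p_L(0)` by
  Loewner antitonicity of `log Z` and `U Σ n↑n↓ ≥ 0`);
* `hotInstance` — for `βU ≤ c_δ` (and `20000·U ≤ c_δ`): some `μ₀` in the window `[−399/100, −1/400000]` carries
  `D_L(β,μ₀;U,g) ≤ log 4/β + ε` eventually: at `β' = max β 20000` the sharp `U = 0` instance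
  (`hw_cruxInstanceSharp_of_differentiablePressure`) gives `D_L(β',μ₀;0,g) ≤ 2h((1−δ)/2)/β' + ε`, the transfer adds
  `U ≤ c_δ/β'`, and Template D (`twSeededEnsembleEquivalence_instance_anti_beta`) descends from `β'` to `β`;
* `twR_polynomialWindow` — the body of `TwSeededEnsembleEquivalenceR` VERBATIM with `Real.exp (a / U)` replaced by
  `a / U` (constants `a := c_δ`, `K' := 1`, `U₀ := c_δ/20000`). Registered form `hw_twR_polynomialWindow`.

READING (for planners; see Cruxes/TwSeededEnsembleEquivalenceR/ROUTE-NOTE-c5.md): R's physics (the deep stubs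
DEEP-DIFF/DEEP-UNIQ′ of Lines/Sketch.lean) lives ENTIRELY on the cold part `β ∈ (c_δ/U, e^{a/U}]` of its window;
on `βU ≤ c_δ` the entropy slack of the crux pays for the repulsion outright. With a polynomial thermal window the
crux is closed by this file, and the route's other T > 0 inputs fall in the single-scale regime `Uβ ≤ c`.
[folklore composition]
-/

set_option linter.dupNamespace false

namespace Summit.HubbardSuperconductivity.HubbardSuperconductivity.Theorems.TwSeededEnsembleEquivalenceR.HotWindow

open Matrix Filter Topology Finset Literature.MathematicalPhysics.QuantumLattice
open Summit.HubbardSuperconductivity.HubbardSuperconductivity.Theorems.TwSeededEnsembleEquivalence.ThermalDuality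
open Summit.HubbardSuperconductivity.HubbardSuperconductivity.Theorems.TwSeededEnsembleEquivalence.Negative
open Summit.HubbardSuperconductivity.HubbardSuperconductivity.Theorems.TwSeededEnsembleEquivalenceR.ColdFloorLine
open scoped ComplexOrder Matrix.Norms.L2Operator

noncomputable section

/-! ### Step 1 — the free seeded pressure: (TDL)+(DIFF)+(EDGE) at every `β ≥ 20000` -/

/-- **(TDL)+(DIFF)+(EDGE) of the FREE seeded pressure at every `β ≥ 20000`**, `g ∈ (0, 1/10]`, on the window
`[−399/100, −1/400000]`: the cold assembly S5 run at `U = 0` with the free regularity `hw_freeSeededRegularity`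
in place of the physics stub S4. [folklore composition] -/
theorem freeSeededDifferentiablePressure (δ β g : ℝ) (hδ : δ ∈ Set.Icc (1/10 : ℝ) (2/5 : ℝ)) (hβB : 20000 ≤ β)
    (hg : g ∈ Set.Ioc (0 : ℝ) (1 / 10)) :
    ∃ (b : ℝ → ℝ) (μm μp : ℝ),
      (∀ μ ∈ Set.Icc (-(399 / 100) : ℝ) (-(1 / 400000)), ∀ κ : ℝ, 0 < κ → ∃ L₀ : ℕ, ∀ (L : ℕ) [NeZero L], L₀ ≤ L →
        |Real.log (Matrix.partitionFn β (hubbardTorusWith 2 L 1 0 μ - ((g / (L : ℝ) ^ 2 : ℝ) : ℂ) • ((pairField dWaveFormFactor L)ᴴ * pairField dWaveFormFactor L))).re / (β * (L : ℝ) ^ 2) - b μ| ≤ κ) ∧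
      (∀ μ ∈ Set.Ioo (-(399 / 100) : ℝ) (-(1 / 400000)), DifferentiableAt ℝ b μ) ∧
      μm ∈ Set.Ioo (-(399 / 100) : ℝ) (-(1 / 400000)) ∧ μp ∈ Set.Ioo (-(399 / 100) : ℝ) (-(1 / 400000)) ∧
      deriv b μm ≤ 1 - δ ∧ 1 - δ ≤ deriv b μp := by
  obtain ⟨hg0, hg1⟩ := hg
  have hβ : 0 < β := by linarith
  set H : ℝ := 13 * g + 1 with hHdef
  have hH : 0 ≤ H := by positivity
  -- the free sourced limit, chosen globally (S3 at `U = 0`)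
  choose qf hqf using fun μ h => stub_sourcedPressureLimit β 0 μ h hβ
  -- its cold regularity at this `β` (the free S4)
  obtain ⟨hDU, μm, hμm, μp, hμp, dm, dp, hdm, hdp, hMm, hMp⟩ :=
    hw_freeSeededRegularity δ β g hδ hβB ⟨hg0, hg1⟩ qf (fun μ h => hqf μ h)
  -- sequences `n ↦ p̃_{n+1}` for the inheritance lemmas
  have hseq : ∀ μ h : ℝ, ∀ κ : ℝ, 0 < κ → ∃ N : ℕ, ∀ n, N ≤ n →
      |Real.log (partitionFn β (dWaveSourceTorus (n + 1) 0 μ h)).re / (β * (((n + 1 : ℕ) : ℝ)) ^ 2) -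
        qf μ h| ≤ κ := by
    intro μ h κ hκ
    obtain ⟨L₀, hL₀⟩ := hqf μ h κ hκ
    exact ⟨L₀, fun n hn => hL₀ (n + 1) (by omega)⟩
  -- inherited convexity in `μ`
  have hconv : ∀ h ∈ Set.Icc (-H) H, ConvexOn ℝ Set.univ (fun μ => qf μ h) := by
    intro h _
    refine cfb_convexOn_univ_of_limit (f := fun n μ =>
      Real.log (partitionFn β (dWaveSourceTorus (n + 1) 0 μ h)).re / (β * (((n + 1 : ℕ) : ℝ)) ^ 2))
      (fun n => ?_) (fun μ κ hκ => hseq μ h κ hκ)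
    have := cfb_convexOn_sourcedPressure (n + 1) 0 h hβ
    simpa using this
  -- inherited Lipschitz bounds
  have hLμ : ∀ (μ μ' : ℝ), ∀ h ∈ Set.Icc (-H) H, |qf μ h - qf μ' h| ≤ 2 * |μ - μ'| := by
    intro μ μ' h _
    refine cfb_abs_sub_le_of_limits (hseq μ h) (hseq μ' h) fun n => ?_
    have := cfb_abs_sourcedPressure_sub_mu_le (n + 1) 0 h hβ μ μ'
    simpa using this
  have hLh : ∀ (μ : ℝ), ∀ h ∈ Set.Icc (-H) H, ∀ h' ∈ Set.Icc (-H) H,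
      |qf μ h - qf μ h'| ≤ 8 * Real.sqrt 2 * |h - h'| := by
    intro μ h _ h' _
    refine cfb_abs_sub_le_of_limits (hseq μ h) (hseq μ h') fun n => ?_
    have := abs_sourcedPressure_sub_le (n + 1) 0 μ hβ h h'
    simpa using this
  -- Danskin (S1) at any point with a given common slope
  have hDan : ∀ μ₀ d : ℝ, (∀ h ∈ Set.Icc (-H) H,
      qf μ₀ h - h ^ 2 / g = sSup ((fun h' : ℝ => qf μ₀ h' - h' ^ 2 / g) '' Set.Icc (-H) H) →
        HasDerivAt (fun μ => qf μ h) d μ₀) →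
      HasDerivAt (fun μ => sSup ((fun h' : ℝ => qf μ h' - h' ^ 2 / g) '' Set.Icc (-H) H)) d μ₀ :=
    fun μ₀ d hm => stub_danskinEnvelope qf H g 2 (8 * Real.sqrt 2) μ₀ d hH hconv hLμ hLh hm
  refine ⟨fun μ => sSup ((fun h' : ℝ => qf μ h' - h' ^ 2 / g) '' Set.Icc (-H) H), μm, μp,
    fun μ _ κ hκ => ?_, fun μ hμ => ?_, hμm, hμp, ?_, ?_⟩
  · -- (TDL) of the free seeded pressure at `β`, by AHM + the sourced limit
    exact tw_seededPressureLimit_of_sourcedLimit 0 g β μ (qf μ) hβ hg0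
      (twApproximatingHamiltonian_proof 0 μ β g hβ hg0) (fun h _ => hqf μ h) κ hκ
  · -- (DIFF)
    obtain ⟨d, hd⟩ := hDU μ hμ
    exact (hDan μ d hd).differentiableAt
  · -- (EDGE) at `μm`
    rw [(hDan μm dm hMm).deriv]; exact hdm
  · -- (EDGE) at `μp`
    rw [(hDan μp dp hMp).deriv]; exact hdp

/-! ### Step 2 — the finite-volume defect is `1`-Lipschitz in the repulsion -/

/-- **Coupling transfer of the defect**: `D_L(β,μ;U,g) ≤ D_L(β,μ;0,g) + U` for `U ≥ 0`, `β > 0`, `δ ≥ 0`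
(`e_L(U,g) ≤ e_L(0,g) + U`: `minEnergyOn_seededCan_le_add_U`; `p_L(β,μ,U,g) ≤ p_L(β,μ,0,g)`: Loewner antitonicity
`log_partitionFn_le_of_posSemidef` with `K_U(μ) − K_0(μ) = U Σ_x n_{x↑}n_{x↓} ≥ 0`). [folklore] -/
theorem defect_le_free_add_U (L : ℕ) [NeZero L] {δ U : ℝ} (hδ : 0 ≤ δ) (hU : 0 ≤ U) (g μ : ℝ) {β : ℝ}
    (hβ : 0 < β) :
    ((hubbardTorus 2 L 1 U - ((g / (L : ℝ) ^ 2 : ℝ) : ℂ) • ((pairField dWaveFormFactor L)ᴴ * pairField dWaveFormFactor L)).minEnergyOn (szSector (Λ := FermionTorus 2 L) (2 * ⌊(1 - δ) * (L : ℝ) ^ 2 / 2⌋₊) 0) / (L : ℝ) ^ 2) + (Real.log (Matrix.partitionFn β (hubbardTorusWith 2 L 1 U μ - ((g / (L : ℝ) ^ 2 : ℝ) : ℂ) • ((pairField dWaveFormFactor L)ᴴ * pairField dWaveFormFactor L))).re / (β * (L : ℝ) ^ 2)) - μ * ((2 * ⌊(1 - δ) * (L : ℝ) ^ 2 / 2⌋₊)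 : ℝ) / (L : ℝ) ^ 2 ≤
      (((hubbardTorus 2 L 1 0 - ((g / (L : ℝ) ^ 2 : ℝ) : ℂ) • ((pairField dWaveFormFactor L)ᴴ * pairField dWaveFormFactor L)).minEnergyOn (szSector (Λ := FermionTorus 2 L) (2 * ⌊(1 - δ) * (L : ℝ) ^ 2 / 2⌋₊) 0) / (L : ℝ) ^ 2) + (Real.log (Matrix.partitionFn β (hubbardTorusWith 2 L 1 0 μ - ((g / (L : ℝ) ^ 2 : ℝ) : ℂ) • ((pairField dWaveFormFactor L)ᴴ * pairField dWaveFormFactor L))).re / (β * (L : ℝ) ^ 2)) - μ * ((2 * ⌊(1 - δ) * (L : ℝ) ^ 2 / 2⌋₊) : ℝ) / (L : ℝ) ^ 2) + U := by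
  have hL : 0 < (L : ℝ) ^ 2 := cast_sq_pos_of_neZero L
  have hβL : 0 < β * (L : ℝ) ^ 2 := mul_pos hβ hL
  -- the sector energy
  have hK := szSector_floor_ne_bot L hδ
  have h1 := minEnergyOn_seededCan_le_add_U L hU g _ hK
  have h1' : (hubbardTorus 2 L 1 U - ((g / (L : ℝ) ^ 2 : ℝ) : ℂ) • ((pairField dWaveFormFactor L)ᴴ * pairField dWaveFormFactor L)).minEnergyOn (szSector (Λ := FermionTorus 2 L) (2 * ⌊(1 - δ) * (L : ℝ) ^ 2 / 2⌋₊) 0) / (L : ℝ) ^ 2 ≤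
      (hubbardTorus 2 L 1 0 - ((g / (L : ℝ) ^ 2 : ℝ) : ℂ) • ((pairField dWaveFormFactor L)ᴴ * pairField dWaveFormFactor L)).minEnergyOn (szSector (Λ := FermionTorus 2 L) (2 * ⌊(1 - δ) * (L : ℝ) ^ 2 / 2⌋₊) 0) / (L : ℝ) ^ 2 + U := by
    rw [div_add' _ _ _ hL.ne', div_le_div_iff_of_pos_right hL]
    nlinarith [h1]
  -- the pressure
  have h2 : Real.log (Matrix.partitionFn β (hubbardTorusWith 2 L 1 U μ - ((g / (L : ℝ) ^ 2 : ℝ) : ℂ) • ((pairField dWaveFormFactor L)ᴴ * pairField dWaveFormFactor L))).re ≤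
      Real.log (Matrix.partitionFn β (hubbardTorusWith 2 L 1 0 μ - ((g / (L : ℝ) ^ 2 : ℝ) : ℂ) • ((pairField dWaveFormFactor L)ᴴ * pairField dWaveFormFactor L))).re := by
    refine log_partitionFn_le_of_posSemidef (tw_isHermitian_seededGC L 0 μ g) (tw_isHermitian_seededGC L U μ g)
      hβ.le ?_
    rw [seededGC_sub_seededGC_U L 0 U μ g]
    exact (posSemidef_sum_numberOp_mul_numberOp (Λ := FermionTorus 2 L)).smul
      (Complex.zero_le_real.2 (by linarith))
  have h2' := div_le_div_of_nonneg_right h2 hβL.le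
  linarith

/-! ### Step 3 — the hot instance -/

/-- **The hot instance.** For `δ ∈ [1/10, 2/5]`, `U > 0`, `g ∈ (0, 1/10]`, `β ≥ 1` with `βU ≤ c_δ` and
`20000·U ≤ c_δ`, `c_δ = log 4 − 2h((1−δ)/2)`: some `μ₀ ∈ [−399/100, −1/400000]` carries the crux inequality
`D_L(β,μ₀;U,g) ≤ log 4/β + ε` for every `ε > 0`, eventually in `L`. (Sharp `U = 0` instance at `β' = max β 20000`,
coupling transfer `+U ≤ c_δ/β'`, Template D from `β'` down to `β`.) [folklore composition] -/
theorem hotInstance (δ U g β : ℝ) (hδ : δ ∈ Set.Icc (1/10 : ℝ) (2/5 : ℝ)) (hU : 0 < U)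
    (hg : g ∈ Set.Ioc (0 : ℝ) (1 / 10)) (hβ1 : 1 ≤ β)
    (hβU : β * U ≤ Real.log 4 - 2 * Real.binEntropy ((1 - δ) / 2))
    (hU0 : 20000 * U ≤ Real.log 4 - 2 * Real.binEntropy ((1 - δ) / 2)) :
    ∃ μ₀ ∈ Set.Icc (-(399 / 100) : ℝ) (-(1 / 400000)), ∀ ε : ℝ, 0 < ε → ∃ L₀ : ℕ, ∀ (L : ℕ) [NeZero L], L₀ ≤ L →
      ((hubbardTorus 2 L 1 U - ((g / (L : ℝ) ^ 2 : ℝ) : ℂ) • ((pairField dWaveFormFactor L)ᴴ * pairField dWaveFormFactor L)).minEnergyOn (szSector (Λ := FermionTorus 2 L) (2 * ⌊(1 - δ) * (L : ℝ) ^ 2 / 2⌋₊) 0) / (L : ℝ) ^ 2) + (Real.log (Matrix.partitionFn β (hubbardTorusWith 2 L 1 U μ₀ - ((g / (L : ℝ) ^ 2 : ℝ) : ℂ) • ((pairField dWaveFormFactor L)ᴴ * pairField dWaveFormFactor L))).re / (β * (L : ℝ) ^ 2)) - μ₀ * ((2 * ⌊(1 - δ) * (L : ℝ) ^ 2 / 2⌋₊)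 : ℝ) / (L : ℝ) ^ 2 ≤ Real.log 4 / β + ε := by
  set c : ℝ := Real.log 4 - 2 * Real.binEntropy ((1 - δ) / 2) with hc
  set β' : ℝ := max β 20000 with hβ'def
  have hβ'B : 20000 ≤ β' := le_max_right _ _
  have hββ' : β ≤ β' := le_max_left _ _
  have hβ'1 : 1 ≤ β' := hβ1.trans hββ'
  have hβ'0 : 0 < β' := by linarith
  have hβ'U : β' * U ≤ c := by
    rcases le_total β 20000 with h | h
    · rw [hβ'def, max_eq_right h]; exact hU0
    · rw [hβ'def, max_eq_left h]; exact hβU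
  obtain ⟨b, μm, μp, hP⟩ := freeSeededDifferentiablePressure δ β' g hδ hβ'B hg
  obtain ⟨μ₀, hμ₀, hinst⟩ := hw_cruxInstanceSharp_of_differentiablePressure δ 0 g β' (-(399 / 100) : ℝ) (-(1 / 400000)) hδ hβ'1
    hg.1.le ⟨b, μm, μp, hP⟩
  refine ⟨μ₀, hμ₀, fun ε hε => ?_⟩
  obtain ⟨L₀, hL₀⟩ := hinst ε hε
  refine ⟨L₀, fun L _ hL => ?_⟩
  have h0 := hL₀ L hL
  have htr := defect_le_free_add_U L (δ := δ) (by linarith [hδ.1]) hU.le g μ₀ hβ'0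
  have hUc : U ≤ c / β' := by
    rw [le_div_iff₀ hβ'0]; linarith
  have hsplit : c / β' = Real.log 4 / β' - 2 * Real.binEntropy ((1 - δ) / 2) / β' := by
    rw [hc, sub_div]
  have hcold : ((hubbardTorus 2 L 1 U - ((g / (L : ℝ) ^ 2 : ℝ) : ℂ) • ((pairField dWaveFormFactor L)ᴴ * pairField dWaveFormFactor L)).minEnergyOn (szSector (Λ := FermionTorus 2 L) (2 * ⌊(1 - δ) * (L : ℝ) ^ 2 / 2⌋₊) 0) / (L : ℝ) ^ 2) + (Real.log (Matrix.partitionFn β' (hubbardTorusWith 2 L 1 U μ₀ - ((g / (L : ℝ) ^ 2 : ℝ) : ℂ) • ((pairField dWaveFormFactor L)ᴴ * pairField dWaveFormFactor L))).re / (β' * (L : ℝ) ^ 2)) - μ₀ * ((2 * ⌊(1 - δ) * (L : ℝ) ^ 2 / 2⌋₊) : ℝ) / (L : ℝ) ^ 2 ≤ Real.log 4 / β' + ε := by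
    linarith
  exact twSeededEnsembleEquivalence_instance_anti_beta L U μ₀ g _ _ (by linarith) hββ' hcold

/-! ### Step 4 — the crux body on the polynomial window -/

/-- **THE HOT-WINDOW THEOREM: the body of `TwSeededEnsembleEquivalenceR` on the POLYNOMIAL thermal window**
`1 ≤ β ≤ a/U` — verbatim the route decl with `Real.exp (a / U)` replaced by `a / U` — holds unconditionally, for every
`δ ∈ [1/10, 2/5]`, with the window `[−399/100, −1/400000]`, `a := c_δ = log 4 − 2h((1−δ)/2)`, `K' := 1`,
`U₀ := c_δ/20000`. [folklore composition] -/
theorem twR_polynomialWindow :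
    ∀ δ ∈ Set.Icc (1/10 : ℝ) (2/5 : ℝ), ∃ μ₁ μ₂ : ℝ, -4 < μ₁ ∧ μ₁ ≤ μ₂ ∧ μ₂ < 0 ∧
      ∃ a K' U₀ : ℝ, 0 < a ∧ 0 < K' ∧ 0 < U₀ ∧ ∀ U ∈ Set.Ioc (0 : ℝ) U₀,
        ∀ g ∈ Set.Icc (K' * U) (1 / 10), ∀ β : ℝ, 1 ≤ β → β ≤ a / U →
          ∃ μ ∈ Set.Icc μ₁ μ₂, ∀ ε : ℝ, 0 < ε → ∃ L₀ : ℕ, ∀ (L : ℕ) [NeZero L], L₀ ≤ L →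
            ((hubbardTorus 2 L 1 U - ((g / (L : ℝ) ^ 2 : ℝ) : ℂ) • ((pairField dWaveFormFactor L)ᴴ * pairField dWaveFormFactor L)).minEnergyOn (szSector (Λ := FermionTorus 2 L) (2 * ⌊(1 - δ) * (L : ℝ) ^ 2 / 2⌋₊) 0) / (L : ℝ) ^ 2) + (Real.log (Matrix.partitionFn β (hubbardTorusWith 2 L 1 U μ - ((g / (L : ℝ) ^ 2 : ℝ) : ℂ) • ((pairField dWaveFormFactor L)ᴴ * pairField dWaveFormFactor L))).re / (β * (L : ℝ) ^ 2)) - μ * ((2 * ⌊(1 - δ) * (L : ℝ) ^ 2 / 2⌋₊) : ℝ) / (L : ℝ) ^ 2 ≤ Real.log 4 / β + ε := by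
  intro δ hδ
  set c : ℝ := Real.log 4 - 2 * Real.binEntropy ((1 - δ) / 2) with hc
  have hcpos : 0 < c := entropySlack_pos (by linarith [hδ.1]) (by linarith [hδ.2])
  refine ⟨(-(399 / 100) : ℝ), (-(1 / 400000)), by norm_num, by norm_num, by norm_num, c, 1, c / 20000, hcpos, one_pos,
    by positivity, fun U hU g hg β hβ1 hβa => ?_⟩
  have hg' : g ∈ Set.Ioc (0 : ℝ) (1 / 10) := ⟨lt_of_lt_of_le (by linarith [hU.1]) hg.1, hg.2⟩
  have hβU : β * U ≤ c := (le_div_iff₀ hU.1).1 hβa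
  have hU0 : 20000 * U ≤ c := by
    have h := hU.2
    rw [le_div_iff₀ (by norm_num : (0 : ℝ) < 20000)] at h
    linarith
  exact hotInstance δ U g β hδ hU.1 hg' hβ1 hβU hU0

/-! ### Registered form -/

/-- **Registered stub `hw_twR_polynomialWindow` (line `Sketch`, crux stmt-HubbardSuperconductivity-15581): the body of
`TwSeededEnsembleEquivalenceR` with the thermal window `β ≤ e^{a/U}` replaced by the polynomial window `β ≤ a/U`,
fully qualified** (= `twR_polynomialWindow`). UNCONDITIONAL. [folklore composition] -/
theorem hw_twR_polynomialWindow : ∀ δ ∈ Set.Icc (1/10 : ℝ) (2/5 : ℝ), ∃ μ₁ μ₂ : ℝ, -4 < μ₁ ∧ μ₁ ≤ μ₂ ∧ μ₂ < 0 ∧ ∃ a K' U₀ : ℝ, 0 < a ∧ 0 < K' ∧ 0 < U₀ ∧ ∀ U ∈ Set.Ioc (0 : ℝ) U₀, ∀ g ∈ Set.Icc (K' * U) (1 / 10), ∀ β : ℝ, 1 ≤ β → β ≤ a / U → ∃ μ ∈ Set.Icc μ₁ μ₂, ∀ ε : ℝ, 0 < ε → ∃ L₀ : ℕ, ∀ (L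 : ℕ) [NeZero L], L₀ ≤ L → (((Literature.MathematicalPhysics.QuantumLattice.hubbardTorus 2 L 1 U - ((g / (L : ℝ) ^ 2 : ℝ) : ℂ) • ((Literature.MathematicalPhysics.QuantumLattice.pairField Literature.MathematicalPhysics.QuantumLattice.dWaveFormFactor L)ᴴ * Literature.MathematicalPhysics.QuantumLattice.pairField Literature.MathematicalPhysics.QuantumLattice.dWaveFormFactor L))).minEnergyOn (Literature.MathematicalPhysics.QuantumLattice.szSector (Λ := Literature.MathematicalPhysics.QuantumLattice.FermionTorus 2 L) (2 * ⌊(1 - δ) * (L : ℝ) ^ 2 / 2⌋₊) 0) / (L : ℝ) ^ 2) + (Real.log (Matrix.partitionFn β (Literature.MathematicalPhysics.QuantumLattice.hubbardTorusWith 2 L 1 U μ - ((g / (L : ℝ) ^ 2 : ℝ) : ℂ) • ((Literature.MathematicalPhysics.QuantumLattice.pairField Literature.MathematicalPhysics.QuantumLattice.dWaveFormFactor L)ᴴ * Literature.MathematicalPhysics.QuantumLattice.pairField Literature.MathematicalPhysics.QuantumLattice.dWaveFormFactor L))).re / (β * (L : ℝ) ^ 2)) - μ * ((2 * ⌊(1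 - δ) * (L : ℝ) ^ 2 / 2⌋₊) : ℝ) / (L : ℝ) ^ 2 ≤ Real.log 4 / β + ε :=
  twR_polynomialWindow

end

end Summit.HubbardSuperconductivity.HubbardSuperconductivity.Theorems.TwSeededEnsembleEquivalenceR.HotWindow
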